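import Literature.NumberTheory.Rogawski1990.LocalTransferChartRealisationStable   -- ★ `stableOrbitalIntegralRel_finset_sum_of_isLocSmooth`
import Literature.NumberTheory.Rogawski1990.LocalTransferGlueCM                     -- ★ `localStableOrbitalIntegralH_add_of_isLocSmooth` (the CM additivity `hA`)
import Literature.NumberTheory.Rogawski1990.RankOneEulerPoincareGlue                -- ★ `IsLocSmooth.const_smul`
import Literature.NumberTheory.Automorphic.LocalStableOrbitalFinite                 -- ★ `stableOrbitalIntegralRel_smul_fun`
import HarnessLib

/-!
# The END's junction at the identity: a local transfer from finitely many POPULATION CLAUSES sharing one finite H-side basis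

Topic `NumberTheory/Rogawski1990`; namespace `Literature.NumberTheory.Rogawski1990`.  THEOREMS ONLY (no definition, no instance, no notation, no named fact, no `sorry`).
Cell `pub/hodgecm-mathlib`, crux H413, road «S3-tree», **END fold** (holder F0P3a-p03 (g15); architect A-84 (3)∕A-86: the PARTIAL HEAD
`localTransferAtOne_of_hyperspecialLevel_le_two` and T3′ HEAD v4's `depthZeroKappaTransfer_hyperspecial_of_populations` are both this junction applied to their
population clauses).  HC_CM is proved only modulo the cell's 2 remaining named inputs (hLiu418, h413) until rung 0 closes; this file is unconditional linear algebra.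

THE MATHEMATICS.  If finitely many «populations» `P_i` cover the regular elements and, for each `i`, on a neighbourhood `V_i ∈ 𝓝 1` of `H` the `G′`-side quantity
`RHS(γ_H)` (for the letter: `Σᶠ_c Δ‴_v(γ_H, c)·Φ(c, g)`) equals the SAME finite combination `Σ_s a_s · Φ^st(γ_H, ψ_s)` of stable orbital integrals of `C_c^∞` functions
`ψ_s` for every regular `γ_H ∈ V_i ∩ P_i`, then `φH := Σ_s a_s • ψ_s ∈ C_c^∞(H)` satisfies `Φ^st(γ_H, φH) = RHS(γ_H)` for every regular `γ_H ∈ ⋂_i V_i` — additivity and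
homogeneity of `Φ^st(γ_H, ·)` on `C_c^∞` at regular `γ_H` (★ `stableOrbitalIntegralRel_finset_sum_of_isLocSmooth`, ★ `stableOrbitalIntegralRel_smul_fun`).  At the CM
carriers (§2) the populations are the trichotomy of T3′ HEAD v4 (type (1): `χ_g` splits over `L_w`, not Levi; type (2): `χ_g` has no root in `L_w`; Levi), the additivity is
★ `localStableOrbitalIntegralH_add_of_isLocSmooth` for a family admissible on the `G`-regular classes, and `RHS` is the letter's `Δ‴`-weighted class sum for ANY transfer
factor data `T`, ANY family `m_G` and ANY `g`.

* §1 `exists_isLocSmooth_stableOrbitalIntegralRel_eq_of_cover` (generic topological group).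
* §2 **`localTransferAtOne_of_populations`** — the CM junction in HEAD v4's clause shapes.

## References
* [Rogawski1990] J. D. Rogawski, *Automorphic Representations of Unitary Groups in Three Variables* (1990), §4.3 (4.3.1)–(4.3.2) p. 43; §4.9 Prop. 4.9.1 (a) pp. 54–55.
* [LanglandsShelstad1987] R. P. Langlands, D. Shelstad, *On the definition of transfer factors*, Math. Ann. 278 (1987), §1.3.
-/

set_option autoImplicit false

noncomputable section

open MeasureTheory Measure Set Filter Topology NumberField IsDedekindDomain Matrix Polynomial
open scoped Matrix MatrixGroups

namespace Literature.NumberTheory.Rogawski1990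

open Literature.NumberTheory.Automorphic Literature.NumberTheory.Automorphic.UnitaryGroup

/-! ## §1 Generic: one `C_c^∞` function from finitely many population clauses -/

section Generic

variable {A : Type*} [Group A] [TopologicalSpace A] [∀ a : A, MeasurableSpace (A ⧸ Subgroup.centralizer ({a} : Set A))]

/-- **`Φ^st(x, Σ_s a_s • ψ_s) = Σ_s a_s · Φ^st(x, ψ_s)`** at a regular `x` for `ψ_s ∈ C_c^∞` (additivity `hA` at regular points + homogeneity).
[cite: Rogawski1990, §4.3 (4.3.1) p. 43] -/
theorem stableOrbitalIntegralRel_sum_smul_of_isLocSmooth {stA : A → A → Prop} {regA : A → Prop} (mH : OrbitalMeasureFamily A)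
    (hA : ∀ a, regA a → ∀ F G : A → ℂ, IsLocSmooth F → IsLocSmooth G →
      stableOrbitalIntegralRel stA mH (F + G) a = stableOrbitalIntegralRel stA mH F a + stableOrbitalIntegralRel stA mH G a)
    {r : ℕ} (ψ : Fin r → A → ℂ) (hψ : ∀ s, IsLocSmooth (ψ s)) (a : Fin r → ℂ) {x : A} (hx : regA x) :
    stableOrbitalIntegralRel stA mH (∑ s, a s • ψ s) x = ∑ s, a s * stableOrbitalIntegralRel stA mH (ψ s) x := by
  rw [stableOrbitalIntegralRel_finset_sum_of_isLocSmooth mH hA hx Finset.univ (fun s => a s • ψ s) fun s _ => (hψ s).const_smul (a s)]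
  exact Finset.sum_congr rfl fun s _ => stableOrbitalIntegralRel_smul_fun stA mH (a s) (ψ s) x

/-- **ONE `C_c^∞` TRANSFER FROM FINITELY MANY POPULATION CLAUSES.**  Populations `P_i` (`i ∈ ι` finite) covering the regular elements; for each `i` a neighbourhood
`V_i ∈ 𝓝 1` on which `RHS(x) = Σ_s a_s · Φ^st(x, ψ_s)` for regular `x ∈ P_i`, with ONE finite family `ψ_s ∈ C_c^∞` and ONE coefficient vector `a`.  Then
`φH := Σ_s a_s • ψ_s ∈ C_c^∞` and `Φ^st(x, φH) = RHS(x)` for every regular `x ∈ ⋂_i V_i ∈ 𝓝 1`. [cite: Rogawski1990, §4.3 (4.3.1)–(4.3.2) p. 43; §4.9 Prop. 4.9.1 (a) p. 55] -/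
theorem exists_isLocSmooth_stableOrbitalIntegralRel_eq_of_cover {stA : A → A → Prop} {regA : A → Prop} (mH : OrbitalMeasureFamily A)
    (hA : ∀ a, regA a → ∀ F G : A → ℂ, IsLocSmooth F → IsLocSmooth G →
      stableOrbitalIntegralRel stA mH (F + G) a = stableOrbitalIntegralRel stA mH F a + stableOrbitalIntegralRel stA mH G a)
    {r : ℕ} (ψ : Fin r → A → ℂ) (hψ : ∀ s, IsLocSmooth (ψ s)) (a : Fin r → ℂ) (RHS : A → ℂ)
    {ι : Type*} [Finite ι] (P : ι → A → Prop) (hcover : ∀ x, regA x → ∃ i, P i x)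
    (h : ∀ i, ∃ V ∈ 𝓝 (1 : A), ∀ x ∈ V, regA x → P i x → RHS x = ∑ s, a s * stableOrbitalIntegralRel stA mH (ψ s) x) :
    ∃ V ∈ 𝓝 (1 : A), ∃ φH : A → ℂ, IsLocSmooth φH ∧ ∀ x ∈ V, regA x → stableOrbitalIntegralRel stA mH φH x = RHS x := by
  choose V hV hVP using h
  refine ⟨⋂ i, V i, (Filter.iInter_mem).2 hV, ∑ s, a s • ψ s, IsLocSmooth.finset_sum Finset.univ fun s _ => (hψ s).const_smul (a s), ?_⟩
  intro x hx hreg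
  obtain ⟨i, hi⟩ := hcover x hreg
  rw [stableOrbitalIntegralRel_sum_smul_of_isLocSmooth mH hA ψ hψ a hreg, hVP i x (Set.mem_iInter.1 hx i) hreg hi]

end Generic

/-! ## §2 The CM junction: T3′'s trichotomy at a finite place -/

section CM

variable (L : Type) [Field L] [NumberField L] [IsCMField L] (H' : Matrix (Fin 3) (Fin 3) L) (v : HeightOneSpectrum (𝓞 ↥(maximalRealSubfield L)))
  (w : PlacesOver L v)
  [∀ γ : ((cmDatum L 3 H').Local v), MeasurableSpace (((cmDatum L 3 H').Local v) ⧸ Subgroup.centralizer ({γ} : Set ((cmDatum L 3 H').Local v)))]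
  [∀ a : (cmDatum L 2 (Matrix.of fun i j : Fin 2 => if i.val + j.val + 1 = 2 then (1 : L) else 0)).Local v × (cmDatum L 1 (Matrix.of fun i j : Fin 1 => if i.val + j.val + 1 = 1 then (1 : L) else 0)).Local v, MeasurableSpace (((cmDatum L 2 (Matrix.of fun i j : Fin 2 => if i.val + j.val + 1 = 2 then (1 : L) else 0)).Local v × (cmDatum L 1 (Matrix.of fun i j : Fin 1 => if i.val + j.val + 1 = 1 then (1 : L) else 0)).Local v) ⧸ Subgroup.centralizer ({a} : Set ((cmDatum L 2 (Matrix.of fun i j : Fin 2 => if i.val + j.val + 1 = 2 then (1 : L) else 0)).Local v × (cmDatum L 1 (Matrix.of fun i j : Fin 1 => if i.val + j.val + 1 = 1 then (1 : L) else 0)).Local v)))]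
  [∀ a : (cmDatum L 2 (Matrix.of fun i j : Fin 2 => if i.val + j.val + 1 = 2 then (1 : L) else 0)).Local v × (cmDatum L 1 (Matrix.of fun i j : Fin 1 => if i.val + j.val + 1 = 1 then (1 : L) else 0)).Local v, BorelSpace (((cmDatum L 2 (Matrix.of fun i j : Fin 2 => if i.val + j.val + 1 = 2 then (1 : L) else 0)).Local v × (cmDatum L 1 (Matrix.of fun i j : Fin 1 => if i.val + j.val + 1 = 1 then (1 : L) else 0)).Local v) ⧸ Subgroup.centralizer ({a} : Set ((cmDatum L 2 (Matrix.of fun i j : Fin 2 => if i.val + j.val + 1 = 2 then (1 : L) else 0)).Local v × (cmDatum L 1 (Matrix.of fun i j : Fin 1 => if i.val + j.val + 1 = 1 then (1 : L) else 0)).Local v)))]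

/-- **THE END'S JUNCTION AT THE IDENTITY (CM carriers).**  Let `g : G′_v → ℂ`, `m_G`, a transfer factor data `T` be arbitrary, and let `m_H` be admissible on the
`G`-regular classes (e.g. canonical: ★ `IsCanonical.isAdmissibleOn`).  If ONE finite family `ψ_s ∈ C_c^∞(H_v)` with coefficients `a_s` realises the `Δ`-weighted class
sum of `g` on each of T3′'s three populations near `1` — type (1): `χ_{γ_H.1, w}` has a root in `L_w` and `γ_H` is not `H_v`-conjugate to a diagonal element; type (2): no root;
Levi: conjugate to a diagonal element (the clause shapes of HEAD v4 `depthZeroKappaTransfer_hyperspecial_{typeOne,typeTwo,levi}` VERBATIM) — then `φH := Σ_s a_s • ψ_s` is a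
local transfer of `g` at the identity: `∃ V ∈ 𝓝 1, ∃ φH ∈ C_c^∞, ∀ γH ∈ V, IsLocalGRegular γH → Φ^st(γ_H, φH) = Σᶠ_c Δ(γ_H, c)·Φ(c, g)` (the letter's conclusion).
[cite: Rogawski1990, §4.3 (4.3.1)–(4.3.2) p. 43; §4.9 Prop. 4.9.1 (a) pp. 54–55] [cite: LanglandsShelstad1987, §1.3] -/
theorem localTransferAtOne_of_populations
    {mH : OrbitalMeasureFamily ((cmDatum L 2 (Matrix.of fun i j : Fin 2 => if i.val + j.val + 1 = 2 then (1 : L) else 0)).Local v × (cmDatum L 1 (Matrix.of fun i j : Fin 1 => if i.val + j.val + 1 = 1 then (1 : L) else 0)).Local v)} (hmH : mH.IsAdmissibleOn (IsLocalGRegular L v))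
    (T : LocalTransferFactor L H' v) (mG : OrbitalMeasureFamily ((cmDatum L 3 H').Local v)) (g : ((cmDatum L 3 H').Local v) → ℂ)
    {r : ℕ} (ψ : Fin r → ((cmDatum L 2 (Matrix.of fun i j : Fin 2 => if i.val + j.val + 1 = 2 then (1 : L) else 0)).Local v × (cmDatum L 1 (Matrix.of fun i j : Fin 1 => if i.val + j.val + 1 = 1 then (1 : L) else 0)).Local v) → ℂ) (hψ : ∀ s, IsLocSmooth (ψ s)) (a : Fin r → ℂ)
    (h₁ : ∃ V ∈ 𝓝 (1 : ((cmDatum L 2 (Matrix.of fun i j : Fin 2 => if i.val + j.val + 1 = 2 then (1 : L) else 0)).Local v × (cmDatum L 1 (Matrix.of fun i j : Fin 1 => if i.val + j.val + 1 = 1 then (1 : L) else 0)).Local v)), ∀ γH ∈ V, IsLocalGRegular L v γH →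
      (∃ x : w.1.adicCompletion L, (((((γH).1.val : GL (Fin 2) (UnitaryGroup.LocalRing L v)).val.map (Pi.evalRingHom (fun w' : PlacesOver L v => w'.1.adicCompletion L) w))).charpoly).IsRoot x) →
      ¬ (∃ (y : ((cmDatum L 2 (Matrix.of fun i j : Fin 2 => if i.val + j.val + 1 = 2 then (1 : L) else 0)).Local v × (cmDatum L 1 (Matrix.of fun i j : Fin 1 => if i.val + j.val + 1 = 1 then (1 : L) else 0)).Local v)) (d' : Fin 2 → (UnitaryGroup.LocalRing L v)ˣ),
          glDiagonal 2 (UnitaryGroup.LocalRing L v) d' = ((y * γH * y⁻¹).1.val : GL (Fin 2) (UnitaryGroup.LocalRing L v))) →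
      ∑ᶠ c : ConjClasses ((cmDatum L 3 H').Local v), T.Δ γH (Quotient.out c) * classOrbitalIntegral mG g c =
        ∑ s, a s * stableOrbitalIntegralRel (IsLocalStablyConjH L v) mH (ψ s) γH)
    (h₂ : ∃ V ∈ 𝓝 (1 : ((cmDatum L 2 (Matrix.of fun i j : Fin 2 => if i.val + j.val + 1 = 2 then (1 : L) else 0)).Local v × (cmDatum L 1 (Matrix.of fun i j : Fin 1 => if i.val + j.val + 1 = 1 then (1 : L) else 0)).Local v)), ∀ γH ∈ V, IsLocalGRegular L v γH →
      ¬ (∃ x : w.1.adicCompletion L, (((((γH).1.val : GL (Fin 2) (UnitaryGroup.LocalRing L v)).val.map (Pi.evalRingHom (fun w' : PlacesOver L v => w'.1.adicCompletion L) w))).charpoly).IsRoot x) →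
      ∑ᶠ c : ConjClasses ((cmDatum L 3 H').Local v), T.Δ γH (Quotient.out c) * classOrbitalIntegral mG g c =
        ∑ s, a s * stableOrbitalIntegralRel (IsLocalStablyConjH L v) mH (ψ s) γH)
    (h₃ : ∃ V ∈ 𝓝 (1 : ((cmDatum L 2 (Matrix.of fun i j : Fin 2 => if i.val + j.val + 1 = 2 then (1 : L) else 0)).Local v × (cmDatum L 1 (Matrix.of fun i j : Fin 1 => if i.val + j.val + 1 = 1 then (1 : L) else 0)).Local v)), ∀ γH ∈ V, IsLocalGRegular L v γH →
      (∃ (y : ((cmDatum L 2 (Matrix.of fun i j : Fin 2 => if i.val + j.val + 1 = 2 then (1 : L) else 0)).Local v × (cmDatum L 1 (Matrix.of fun i j : Fin 1 => if i.val + j.val + 1 = 1 then (1 : L) else 0)).Local v)) (d' : Fin 2 → (UnitaryGroup.LocalRing L v)ˣ),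
          glDiagonal 2 (UnitaryGroup.LocalRing L v) d' = ((y * γH * y⁻¹).1.val : GL (Fin 2) (UnitaryGroup.LocalRing L v))) →
      ∑ᶠ c : ConjClasses ((cmDatum L 3 H').Local v), T.Δ γH (Quotient.out c) * classOrbitalIntegral mG g c =
        ∑ s, a s * stableOrbitalIntegralRel (IsLocalStablyConjH L v) mH (ψ s) γH) :
    ∃ V ∈ 𝓝 (1 : ((cmDatum L 2 (Matrix.of fun i j : Fin 2 => if i.val + j.val + 1 = 2 then (1 : L) else 0)).Local v × (cmDatum L 1 (Matrix.of fun i j : Fin 1 => if i.val + j.val + 1 = 1 then (1 : L) else 0)).Local v)), ∃ φH : ((cmDatum L 2 (Matrix.of fun i j : Fin 2 => if i.val + j.val + 1 = 2 then (1 : L) else 0)).Local v × (cmDatum L 1 (Matrix.of fun i j : Fin 1 => if i.val + j.val + 1 = 1 then (1 : L) else 0)).Local v) → ℂ, IsLocSmooth φH ∧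
      ∀ γH ∈ V, IsLocalGRegular L v γH →
        stableOrbitalIntegralRel (IsLocalStablyConjH L v) mH φH γH =
          ∑ᶠ c : ConjClasses ((cmDatum L 3 H').Local v), T.Δ γH (Quotient.out c) * classOrbitalIntegral mG g c := by
  -- the three populations, indexed by `Fin 3`
  let P : Fin 3 → ((cmDatum L 2 (Matrix.of fun i j : Fin 2 => if i.val + j.val + 1 = 2 then (1 : L) else 0)).Local v × (cmDatum L 1 (Matrix.of fun i j : Fin 1 => if i.val + j.val + 1 = 1 then (1 : L) else 0)).Local v) → Prop := fun i γH =>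
    if i = 0 then
      (∃ x : w.1.adicCompletion L, (((((γH).1.val : GL (Fin 2) (UnitaryGroup.LocalRing L v)).val.map (Pi.evalRingHom (fun w' : PlacesOver L v => w'.1.adicCompletion L) w))).charpoly).IsRoot x) ∧
        ¬ (∃ (y : ((cmDatum L 2 (Matrix.of fun i j : Fin 2 => if i.val + j.val + 1 = 2 then (1 : L) else 0)).Local v × (cmDatum L 1 (Matrix.of fun i j : Fin 1 => if i.val + j.val + 1 = 1 then (1 : L) else 0)).Local v)) (d' : Fin 2 → (UnitaryGroup.LocalRing L v)ˣ),
          glDiagonal 2 (UnitaryGroup.LocalRing L v) d' = ((y * γH * y⁻¹).1.val : GL (Fin 2) (UnitaryGroup.LocalRing L v)))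
    else if i = 1 then ¬ (∃ x : w.1.adicCompletion L, (((((γH).1.val : GL (Fin 2) (UnitaryGroup.LocalRing L v)).val.map (Pi.evalRingHom (fun w' : PlacesOver L v => w'.1.adicCompletion L) w))).charpoly).IsRoot x)
    else ∃ (y : ((cmDatum L 2 (Matrix.of fun i j : Fin 2 => if i.val + j.val + 1 = 2 then (1 : L) else 0)).Local v × (cmDatum L 1 (Matrix.of fun i j : Fin 1 => if i.val + j.val + 1 = 1 then (1 : L) else 0)).Local v)) (d' : Fin 2 → (UnitaryGroup.LocalRing L v)ˣ),
      glDiagonal 2 (UnitaryGroup.LocalRing L v) d' = ((y * γH * y⁻¹).1.val : GL (Fin 2) (UnitaryGroup.LocalRing L v))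
  have hA := fun x (hx : IsLocalGRegular L v x) F G (hF : IsLocSmooth F) (hG : IsLocSmooth G) =>
    localStableOrbitalIntegralH_add_of_isLocSmooth L v hmH x hx F G hF hG
  refine exists_isLocSmooth_stableOrbitalIntegralRel_eq_of_cover mH hA ψ hψ a _ P ?_ ?_
  · -- cover: Levi, else split (hence type (1)), else type (2)
    intro γH _
    by_cases hL : ∃ (y : ((cmDatum L 2 (Matrix.of fun i j : Fin 2 => if i.val + j.val + 1 = 2 then (1 : L) else 0)).Local v × (cmDatum L 1 (Matrix.of fun i j : Fin 1 => if i.val + j.val + 1 = 1 then (1 : L) else 0)).Local v)) (d' : Fin 2 → (UnitaryGroup.LocalRing L v)ˣ),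
        glDiagonal 2 (UnitaryGroup.LocalRing L v) d' = ((y * γH * y⁻¹).1.val : GL (Fin 2) (UnitaryGroup.LocalRing L v))
    · exact ⟨2, by simp only [P, Fin.isValue, show (2 : Fin 3) ≠ 0 by decide, show (2 : Fin 3) ≠ 1 by decide, if_false]; exact hL⟩
    · by_cases hS : ∃ x : w.1.adicCompletion L, (((((γH).1.val : GL (Fin 2) (UnitaryGroup.LocalRing L v)).val.map (Pi.evalRingHom (fun w' : PlacesOver L v => w'.1.adicCompletion L) w))).charpoly).IsRoot x
      · exact ⟨0, by simp only [P, Fin.isValue, if_true]; exact ⟨hS, hL⟩⟩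
      · exact ⟨1, by simp only [P, Fin.isValue, show (1 : Fin 3) ≠ 0 by decide, if_false, if_true]; exact hS⟩
  · intro i
    fin_cases i
    · obtain ⟨V, hV, h⟩ := h₁
      exact ⟨V, hV, fun γH hγ hreg hP => by
        simp only [P, Fin.zero_eta, Fin.isValue, if_true] at hP
        exact h γH hγ hreg hP.1 hP.2⟩
    · obtain ⟨V, hV, h⟩ := h₂
      exact ⟨V, hV, fun γH hγ hreg hP => by
        simp only [P, Fin.mk_one, Fin.isValue, show (1 : Fin 3) ≠ 0 by decide, if_false, if_true] at hP
        exact h γH hγ hreg hP⟩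
    · obtain ⟨V, hV, h⟩ := h₃
      exact ⟨V, hV, fun γH hγ hreg hP => by
        simp only [P, Fin.reduceFinMk, Fin.isValue, show (2 : Fin 3) ≠ 0 by decide, show (2 : Fin 3) ≠ 1 by decide, if_false] at hP
        exact h γH hγ hreg hP⟩

end CM

end Literature.NumberTheory.Rogawski1990

end
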